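import Mathlib.Tactic.Linarith
import Mathlib.Tactic.NormNum
import Summits.Ventures.CertifiedManyBodySolver.Downfold.PhaseMapGridResolution

/-!
# Low-temperature coverage of a NOT verdict (ACCEPTANCE v1.9 ITEM 8, queued): the §4.5 verdict is grid-dependent by
# letter in v1.8, and item 8 makes NOT a claim backed at every canonical low-T point

Venture CertifiedManyBodySolver, cell `pub/hubbard-downfold`, seat hubbard-downfold-score-1 (second scoring engine);
namespace `Summit.Ventures.CertifiedManyBodySolver.Downfold.CellScore` (continues `PhaseMapMaterialVerdict.lean` §1 `verdict` /
`kind` and `PhaseMapGridResolution.lean` `T22`). Context (2026-08-27): ACCEPTANCE v1.8 §4.5 reads NOT as «every cell with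
T ≥ T_floor is «not» and no band reaches 0.1 K» over WHATEVER temperatures the map's grid carries (§2.4 makes a non-T22 grid a
warning W1w, scored cell by cell). score-1 g7 observed (ladder INBOX 06:15:07Z) that the material verdict is therefore
grid-dependent: the same producer («not» above an e–ph ceiling, undetermined below it) is ABSTAIN on T22 and NOT — hence TN on a
non-superconductor and FN on a superconductor — on a sparse grid that omits the low-T points. deputy-2 QUEUED it as v1.9 ITEM 8
(V18-QUEUE 06:15:30Z; ISSUE-KIT 08:31Z), letter: «§4.5 NOT additionally requires «not» cells covering [T_floor, 10 K] on the
deciding column (at least the canonical points T_floor ≤ T ≤ 10 K present and «not»); otherwise ABSTAIN(grid). SC is unaffected.»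
The second engine stages it as flag `NOT_LOWT_COVERAGE_ITEM8` (phasemap ≥ 1.8.19). Everything below is PROVED; 0 maps of record are
affected (every assembled map carries exactly T22 — `verdict8_eq_verdict_of_T22`).

WHAT THIS IS NOT: not the ruling and not a statement about any material — the kernel form of item 8's CONSEQUENCES, so the letter
can be read against exact statements:

* §1 definitions: `lowTOwed T_floor` = the canonical points owed (T ∈ T22, T_floor ≤ T ≤ 10); `lowTCovered` = all owed points are
  grid temperatures of the column; `verdict8` = the item-8 verdict (a v1.8 NOT without coverage becomes UNDETERMINED).
* §2 property sheet: item 8 only REMOVES NOT verdicts (`verdict8_eq_NOT_iff`, `verdict_eq_NOT_of_verdict8`), never touches SC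
  (`verdict8_eq_SC_iff`), so it creates no FP and no FN and every item-8 kind is the v1.8 kind or ABSTAIN (`kind_verdict8`);
  COVERAGE SOUNDNESS: an item-8 NOT carries an explicit «not» cell AT every owed canonical point (`owed_point_reads_not`); it is the
  identity on any grid containing the owed points — in particular on T22 itself (`verdict8_eq_verdict_of_T22`, the pen's control
  shape) — and vacuous when T_floor > 10 K (`lowTOwed_eq_nil_of_gt_ten`).
* §3 the v1.8 grid dependence, as a witness: one producer, two grids, two verdicts (`v18_grid_dependence`); item 8 sends the sparse
  one to ABSTAIN for either truth class (`item8_sparse_abstain`) = the pen's two selftest shapes (TN → ABSTAIN, FN → ABSTAIN), the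
  T22 control is unchanged (`item8_T22_control`), only the owed points matter (`item8_partial_lowT`), SC untouched (`item8_sparse_SC`).
-/

namespace Summit.Ventures.CertifiedManyBodySolver.Downfold

namespace CellScore

/-! ## §1 Item 8 as a total function -/

/-- The canonical low-temperature points a NOT verdict owes (item 8): `T ∈ T22` with `T_floor ≤ T ≤ 10`. [folklore] -/
def lowTOwed (Tfloor : ℚ) : List ℚ :=
  T22.filter (fun T => decide (Tfloor ≤ T) && decide (T ≤ 10))

/-- Item 8's coverage predicate on one column: every owed canonical point is a grid temperature of the column. [folklore] -/
def lowTCovered (Tfloor : ℚ) (cells : List (ℚ × Word)) : Bool :=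
  (lowTOwed Tfloor).all (fun T => cells.any (fun c => decide (c.1 = T)))

/-- ACCEPTANCE v1.9 item 8 material verdict: the v1.8 verdict, except that NOT without low-T coverage is UNDETERMINED
(«ABSTAIN(grid)»). [folklore] -/
def verdict8 (Tfloor : ℚ) (cells : List (ℚ × Word)) (bands : List (ℚ × ℚ)) : Verdict :=
  if verdict Tfloor cells bands = .NOT ∧ lowTCovered Tfloor cells = false then .UNDETERMINED else verdict Tfloor cells bands

section props

variable {Tfloor : ℚ} {cells : List (ℚ × Word)} {bands : List (ℚ × ℚ)}

/-- membership in the owed list, unfolded. [folklore] -/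
theorem mem_lowTOwed {T : ℚ} : T ∈ lowTOwed Tfloor ↔ T ∈ T22 ∧ Tfloor ≤ T ∧ T ≤ 10 := by
  simp [lowTOwed, Bool.and_eq_true, decide_eq_true_eq]

/-- coverage, unfolded: every owed point is some cell's temperature. [folklore] -/
theorem lowTCovered_eq_true_iff :
    lowTCovered Tfloor cells = true ↔ ∀ T ∈ lowTOwed Tfloor, ∃ c ∈ cells, c.1 = T := by
  simp [lowTCovered, List.all_eq_true, List.any_eq_true, decide_eq_true_eq]

/-- Vacuous case: a non-superconductor measured down to `T_min > 10 K` owes no canonical point. [folklore] -/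
theorem lowTOwed_eq_nil_of_gt_ten (h : 10 < Tfloor) : lowTOwed Tfloor = [] := by
  rw [lowTOwed, List.filter_eq_nil_iff]
  intro T _ hT
  simp only [Bool.and_eq_true, decide_eq_true_eq] at hT
  linarith [hT.1, hT.2]

/-- … hence coverage holds vacuously when `T_floor > 10`. [folklore] -/
theorem lowTCovered_of_gt_ten (h : 10 < Tfloor) : lowTCovered Tfloor cells = true := by
  simp [lowTCovered, lowTOwed_eq_nil_of_gt_ten h]

/-- The owed points of a known superconductor (`T_floor = 1/10`): the seven canonical temperatures 0.1 … 10 K. [folklore] -/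
theorem lowTOwed_tenth : lowTOwed (1 / 10) = [1/10, 3/10, 1, 2, 4, 6, 10] := by
  norm_num [lowTOwed, T22]

/-- The owed points of a La₂CuO₄-type non-superconductor measured down to 4.2 K: {6, 10}. [folklore] -/
theorem lowTOwed_42 : lowTOwed (42 / 10) = [6, 10] := by
  norm_num [lowTOwed, T22]

/-! ## §2 Property sheet -/

/-- Item 8 never touches SC: `verdict8 = SC ↔ verdict = SC`. [folklore] -/
theorem verdict8_eq_SC_iff : verdict8 Tfloor cells bands = .SC ↔ verdict Tfloor cells bands = .SC := by
  unfold verdict8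
  by_cases hN : verdict Tfloor cells bands = .NOT
  · cases lowTCovered Tfloor cells <;> simp [hN]
  · simp [hN]

/-- Item 8 NOT = v1.8 NOT with coverage. [folklore] -/
theorem verdict8_eq_NOT_iff :
    verdict8 Tfloor cells bands = .NOT ↔ verdict Tfloor cells bands = .NOT ∧ lowTCovered Tfloor cells = true := by
  unfold verdict8
  by_cases hN : verdict Tfloor cells bands = .NOT
  · cases lowTCovered Tfloor cells <;> simp [hN]
  · simp [hN]

/-- Item 8 only removes NOT verdicts. [folklore] -/
theorem verdict_eq_NOT_of_verdict8 (h : verdict8 Tfloor cells bands = .NOT) : verdict Tfloor cells bands = .NOT :=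
  (verdict8_eq_NOT_iff.mp h).1

/-- Identity wherever the owed points are on the grid. [folklore] -/
theorem verdict8_eq_verdict_of_covered (h : lowTCovered Tfloor cells = true) :
    verdict8 Tfloor cells bands = verdict Tfloor cells bands := by
  unfold verdict8
  simp [h]

/-- Vacuous above 10 K: identity. [folklore] -/
theorem verdict8_eq_verdict_of_gt_ten (h : 10 < Tfloor) : verdict8 Tfloor cells bands = verdict Tfloor cells bands :=
  verdict8_eq_verdict_of_covered (lowTCovered_of_gt_ten h)

/-- Either the v1.8 verdict or UNDETERMINED — item 8 has no third outcome. [folklore] -/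
theorem verdict8_eq_or :
    verdict8 Tfloor cells bands = verdict Tfloor cells bands ∨ verdict8 Tfloor cells bands = .UNDETERMINED := by
  unfold verdict8
  split_ifs
  · exact Or.inr rfl
  · exact Or.inl rfl

/-- NO NEW ERROR: every item-8 confusion entry is the v1.8 entry or ABSTAIN (so item 8 creates no FP, no FN, no TP, no TN; the decided
count of every class floor can only drop). [folklore] -/
theorem kind_verdict8 (isSC : Bool) :
    kind (verdict8 Tfloor cells bands) isSC = kind (verdict Tfloor cells bands) isSC
      ∨ kind (verdict8 Tfloor cells bands) isSC = .ABSTAIN := by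
  rcases verdict8_eq_or (Tfloor := Tfloor) (cells := cells) (bands := bands) with h | h
  · exact Or.inl (by rw [h])
  · right; rw [h]; cases isSC <;> rfl

/-- In particular item 8 creates no false positive. [folklore] -/
theorem kind_verdict8_FP (isSC : Bool) (h : kind (verdict8 Tfloor cells bands) isSC = .FP) :
    kind (verdict Tfloor cells bands) isSC = .FP := by
  rcases kind_verdict8 (Tfloor := Tfloor) (cells := cells) (bands := bands) isSC with h' | h'
  · rw [← h']; exact h
  · rw [h'] at h; exact Kind.noConfusion h

/-- … and no false negative. [folklore] -/
theorem kind_verdict8_FN (isSC : Bool) (h : kind (verdict8 Tfloor cells bands) isSC = .FN) :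
    kind (verdict Tfloor cells bands) isSC = .FN := by
  rcases kind_verdict8 (Tfloor := Tfloor) (cells := cells) (bands := bands) isSC with h' | h'
  · rw [← h']; exact h
  · rw [h'] at h; exact Kind.noConfusion h

/-- COVERAGE SOUNDNESS: an item-8 NOT carries an explicit «not» cell AT every owed canonical point — the TN credit is backed down to
T_floor on the canonical grid, not inferred from high-temperature cells. [folklore] -/
theorem owed_point_reads_not (h : verdict8 Tfloor cells bands = .NOT) {T : ℚ} (hT : T ∈ lowTOwed Tfloor) :
    ∃ c ∈ cells, c.1 = T ∧ c.2 = Word.not := by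
  obtain ⟨hN, hcov⟩ := verdict8_eq_NOT_iff.mp h
  obtain ⟨c, hc, hcT⟩ := lowTCovered_eq_true_iff.mp hcov T hT
  refine ⟨c, hc, hcT, word_eq_not_of_verdict_NOT hN hc ?_⟩
  rw [hcT]; exact (mem_lowTOwed.mp hT).2.1

/-- A grid that CONTAINS T22 (in particular T22 itself) covers every owed point, whatever T_floor is. [folklore] -/
theorem lowTCovered_of_T22_subset (h : ∀ T ∈ T22, ∃ c ∈ cells, c.1 = T) : lowTCovered Tfloor cells = true := by
  rw [lowTCovered_eq_true_iff]
  intro T hT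
  exact h T (mem_lowTOwed.mp hT).1

/-- 0 MAPS AFFECTED on every run of record: on a T22 column item 8 is the identity (the pen's control shape). [folklore] -/
theorem verdict8_eq_verdict_of_T22 (h : ∀ T ∈ T22, ∃ c ∈ cells, c.1 = T) :
    verdict8 Tfloor cells bands = verdict Tfloor cells bands :=
  verdict8_eq_verdict_of_covered (lowTCovered_of_T22_subset h)

end props

/-! ## §3 The v1.8 grid dependence and the selftest shapes, evaluated -/

/-- constructor disequalities fed to `norm_num` in the evaluations below (closed terms; `decide`). [folklore] -/
theorem Verdict.UNDETERMINED_ne_NOT : Verdict.UNDETERMINED ≠ Verdict.NOT := by decide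
/-- see `Verdict.UNDETERMINED_ne_NOT`. [folklore] -/
theorem Verdict.SC_ne_NOT : Verdict.SC ≠ Verdict.NOT := by decide

/-- The producer of the observation: «not» above an e–ph-type ceiling (120 K), undetermined at/below it. [folklore] -/
def ceilingProducer (T : ℚ) : Word := if 120 < T then Word.not else Word.undetermined

/-- The sparse grid of the pen's selftest shape: T ∈ {0, 130, 160, 200, 250, 300, 350, 400} (a SUBSET of T22 ⇒ no W1w). [folklore] -/
def sparseGrid : List ℚ := [0, 130, 160, 200, 250, 300, 350, 400]

/-- A column written by a producer on a grid. [folklore] -/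
def column (w : ℚ → Word) (Ts : List ℚ) : List (ℚ × Word) := Ts.map (fun T => (T, w T))

/-- The pen's selftest shape literally: every sparse-grid cell «not». [folklore] -/
def sparseAllNot : List (ℚ × Word) := column (fun _ => Word.not) sparseGrid

/-- **v1.8 GRID DEPENDENCE (the 06:15:07Z observation).** One producer, one truth floor (La₂CuO₄-type, T_min = 4.2 K), two grids: on T22
the verdict is UNDETERMINED, on the sparse grid it is NOT. [folklore] -/
theorem v18_grid_dependence :
    verdict (42 / 10) (column ceilingProducer T22) [] = .UNDETERMINED
      ∧ verdict (42 / 10) (column ceilingProducer sparseGrid) [] = .NOT := by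
  constructor <;> norm_num [verdict8, lowTCovered, lowTOwed, verdict, saysSC, saysNOT, relevant, kind, column, ceilingProducer, sparseGrid, sparseAllNot, T22,
    Word.undetermined_ne_SC, Word.not_ne_SC, Word.undetermined_ne_not, Verdict.UNDETERMINED_ne_NOT, Verdict.SC_ne_NOT]

/-- … so v1.8 credits the sparse map with a TN and a known superconductor's copy with an FN, while the T22 maps ABSTAIN. [folklore] -/
theorem v18_sparse_kinds :
    kind (verdict (42 / 10) (column ceilingProducer sparseGrid) []) false = .TN
      ∧ kind (verdict (1 / 10) (column ceilingProducer sparseGrid) []) true = .FN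
      ∧ kind (verdict (42 / 10) (column ceilingProducer T22) []) false = .ABSTAIN
      ∧ kind (verdict (1 / 10) (column ceilingProducer T22) []) true = .ABSTAIN := by
  refine ⟨?_, ?_, ?_, ?_⟩ <;> norm_num [verdict8, lowTCovered, lowTOwed, verdict, saysSC, saysNOT, relevant, kind, column, ceilingProducer, sparseGrid, sparseAllNot, T22,
    Word.undetermined_ne_SC, Word.not_ne_SC, Word.undetermined_ne_not, Verdict.UNDETERMINED_ne_NOT, Verdict.SC_ne_NOT]

/-- The sparse grid covers neither {6, 10} (T_floor 4.2 K) nor {0.1 … 10} (T_floor 0.1 K). [folklore] -/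
theorem sparse_not_covered :
    lowTCovered (42 / 10) (column ceilingProducer sparseGrid) = false
      ∧ lowTCovered (1 / 10) (column ceilingProducer sparseGrid) = false := by
  constructor <;> norm_num [verdict8, lowTCovered, lowTOwed, verdict, saysSC, saysNOT, relevant, kind, column, ceilingProducer, sparseGrid, sparseAllNot, T22,
    Word.undetermined_ne_SC, Word.not_ne_SC, Word.undetermined_ne_not, Verdict.UNDETERMINED_ne_NOT, Verdict.SC_ne_NOT]

/-- **ITEM 8, the pen's selftest shapes:** «T ∈ {0, 130…400} all «not», known-nonSC ⇒ ABSTAIN (was TN); same grid known-SC ⇒ ABSTAIN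
(was FN)» — for either truth class and either producer (ceiling-type or literally all «not»). [folklore] -/
theorem item8_sparse_abstain (isSC : Bool) :
    kind (verdict8 (42 / 10) (column ceilingProducer sparseGrid) []) isSC = .ABSTAIN
      ∧ kind (verdict8 (1 / 10) (column ceilingProducer sparseGrid) []) isSC = .ABSTAIN
      ∧ kind (verdict8 (42 / 10) sparseAllNot []) isSC = .ABSTAIN
      ∧ kind (verdict8 (1 / 10) sparseAllNot []) isSC = .ABSTAIN := by
  cases isSC <;> refine ⟨?_, ?_, ?_, ?_⟩ <;> norm_num [verdict8, lowTCovered, lowTOwed, verdict, saysSC, saysNOT, relevant, kind, column, ceilingProducer, sparseGrid, sparseAllNot, T22,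
    Word.undetermined_ne_SC, Word.not_ne_SC, Word.undetermined_ne_not, Verdict.UNDETERMINED_ne_NOT, Verdict.SC_ne_NOT]

/-- «T22 control unchanged»: all «not» on the full T22 grid stays NOT under item 8 (TN on a non-superconductor). [folklore] -/
theorem item8_T22_control :
    verdict8 (42 / 10) (column (fun _ => Word.not) T22) [] = .NOT
      ∧ kind (verdict8 (42 / 10) (column (fun _ => Word.not) T22) []) false = .TN := by
  constructor <;> norm_num [verdict8, lowTCovered, lowTOwed, verdict, saysSC, saysNOT, relevant, kind, column, ceilingProducer, sparseGrid, sparseAllNot, T22,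
    Word.undetermined_ne_SC, Word.not_ne_SC, Word.undetermined_ne_not, Verdict.UNDETERMINED_ne_NOT, Verdict.SC_ne_NOT]

/-- Only the owed points matter: the sparse grid plus {6, 10} is NOT again for T_floor = 4.2 K (score-1 vector i8-lowT-present-m13),
while plus {6} alone is still UNDETERMINED. [folklore] -/
theorem item8_partial_lowT :
    verdict8 (42 / 10) (column (fun _ => Word.not) ([0, 6, 10, 130, 160, 200, 250, 300, 350, 400] : List ℚ)) [] = .NOT
      ∧ verdict8 (42 / 10) (column (fun _ => Word.not) ([0, 6, 130, 160, 200, 250, 300, 350, 400] : List ℚ)) [] = .UNDETERMINED := by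
  constructor <;> norm_num [verdict8, lowTCovered, lowTOwed, verdict, saysSC, saysNOT, relevant, kind, column, ceilingProducer, sparseGrid, sparseAllNot, T22,
    Word.undetermined_ne_SC, Word.not_ne_SC, Word.undetermined_ne_not, Verdict.UNDETERMINED_ne_NOT, Verdict.SC_ne_NOT]

/-- SC unaffected, evaluated: one «SC» cell on the sparse grid is SC under item 8 too. [folklore] -/
theorem item8_sparse_SC :
    verdict8 (1 / 10) ((0, Word.SC) :: column (fun _ => Word.not) ([130, 160, 200] : List ℚ)) [] = .SC := by
  norm_num [verdict8, lowTCovered, lowTOwed, verdict, saysSC, saysNOT, relevant, kind, column, ceilingProducer, sparseGrid, sparseAllNot, T22,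
    Word.undetermined_ne_SC, Word.not_ne_SC, Word.undetermined_ne_not, Verdict.UNDETERMINED_ne_NOT, Verdict.SC_ne_NOT]

/-! ## §4 APPEND (g9, 2026-08-27T09:3xZ) — the PEN's reading of «the deciding column» (deputy-2 08:39:50Z, verbatim: «(1) YES: the low-T
points are owed on EVERY covered H = 0 headline column (NOT is a conjunction over the headline columns; one sparse column ⇒ the material
ABSTAINs); (2) YES: T_floor > 10 K ⇒ the requirement is vacuous»). §1–§3 model ONE column; a material with several headline columns pools its
cells for the §4.5 verdict (`verdict` on the concatenation). Two coverage readings of the pooled list then exist: POOLED («every owed point is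
SOME column's temperature» = `lowTCovered` on the concatenation) and PER-COLUMN (`lowTCoveredCols`, the pen's (1), = deputy-2 draft-5
cb6a9b7e and phasemap ≥ 1.8.19). Per-column implies pooled (`lowTCovered_flatten_of_cols`), not conversely (`pooled_not_percolumn`: low-T
points on one column only), and the two COINCIDE on a product grid — every column carrying the same temperatures, which is what §2.4/W1
(«grid = axes.T × axes.P × axes.H, complete») guarantees for every accepted map (`lowTCoveredCols_eq_of_sameGrid`). So the readings can differ
only on maps the gate rejects; the kernel records the pen's one as `verdict8Cols`. -/

/-- PER-COLUMN coverage (the pen's reading (1)): every non-empty headline column carries every owed canonical point. [folklore] -/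
def lowTCoveredCols (Tfloor : ℚ) (cols : List (List (ℚ × Word))) : Bool :=
  cols.all (fun col => col.isEmpty || lowTCovered Tfloor col)

/-- Item 8 for a multi-column material: the v1.8 verdict on the pooled cells, NOT withheld unless EVERY column is covered. [folklore] -/
def verdict8Cols (Tfloor : ℚ) (cols : List (List (ℚ × Word))) (bands : List (ℚ × ℚ)) : Verdict :=
  if verdict Tfloor cols.flatten bands = .NOT ∧ lowTCoveredCols Tfloor cols = false then .UNDETERMINED else verdict Tfloor cols.flatten bands

section cols

variable {Tfloor : ℚ} {cols : List (List (ℚ × Word))} {bands : List (ℚ × ℚ)}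

/-- per-column coverage, unfolded. [folklore] -/
theorem lowTCoveredCols_eq_true_iff :
    lowTCoveredCols Tfloor cols = true ↔ ∀ col ∈ cols, col ≠ [] → lowTCovered Tfloor col = true := by
  simp only [lowTCoveredCols, List.all_eq_true, Bool.or_eq_true, List.isEmpty_iff]
  constructor
  · intro h col hc hne
    rcases h col hc with h1 | h1
    · exact absurd h1 hne
    · exact h1
  · intro h col hc
    by_cases hne : col = []
    · exact Or.inl hne
    · exact Or.inr (h col hc hne)

/-- PER-COLUMN ⇒ POOLED: if every non-empty column is covered and some column is non-empty, the concatenation is covered. [folklore] -/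
theorem lowTCovered_flatten_of_cols (h : lowTCoveredCols Tfloor cols = true) (hne : ∃ col ∈ cols, col ≠ []) :
    lowTCovered Tfloor cols.flatten = true := by
  rw [lowTCovered_eq_true_iff]
  intro T hT
  obtain ⟨col, hcol, hcolne⟩ := hne
  have hc := (lowTCoveredCols_eq_true_iff.mp h) col hcol hcolne
  obtain ⟨c, hc1, hc2⟩ := (lowTCovered_eq_true_iff.mp hc) T hT
  exact ⟨c, List.mem_flatten.mpr ⟨col, hcol, hc1⟩, hc2⟩

/-- On a PRODUCT grid (every column carries the same temperatures — §2.4 / W1 for every accepted map) the two readings coincide. [folklore] -/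
theorem lowTCoveredCols_eq_of_sameGrid (Ts : List ℚ) (hgrid : ∀ col ∈ cols, col.map Prod.fst = Ts) (hne : ∃ col ∈ cols, col ≠ []) :
    lowTCoveredCols Tfloor cols = lowTCovered Tfloor cols.flatten := by
  rcases hc : lowTCoveredCols Tfloor cols with _ | _
  · -- some non-empty column misses an owed point; then EVERY column misses it (same grid), so the pooled list misses it too
    symm; rw [Bool.eq_false_iff]; intro hflat
    have hcols : ¬ (lowTCoveredCols Tfloor cols = true) := by rw [hc]; exact Bool.false_ne_true
    apply hcols
    rw [lowTCoveredCols_eq_true_iff]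
    intro col hcol _
    rw [lowTCovered_eq_true_iff]
    intro T hT
    obtain ⟨c, hcflat, hcT⟩ := (lowTCovered_eq_true_iff.mp hflat) T hT
    obtain ⟨col', hcol', hc'⟩ := List.mem_flatten.mp hcflat
    -- T is a temperature of col' hence of Ts hence of col
    have hTs : T ∈ Ts := by rw [← hgrid col' hcol', List.mem_map]; exact ⟨c, hc', hcT⟩
    rw [← hgrid col hcol, List.mem_map] at hTs
    obtain ⟨c2, hc2, hc2T⟩ := hTs
    exact ⟨c2, hc2, hc2T⟩
  · exact (lowTCovered_flatten_of_cols hc hne).symm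

/-- … hence on a product grid the pen's multi-column verdict is §1's `verdict8` on the pooled cells. [folklore] -/
theorem verdict8Cols_eq_verdict8_of_sameGrid (Ts : List ℚ) (hgrid : ∀ col ∈ cols, col.map Prod.fst = Ts) (hne : ∃ col ∈ cols, col ≠ []) :
    verdict8Cols Tfloor cols bands = verdict8 Tfloor cols.flatten bands := by
  unfold verdict8Cols verdict8
  rw [lowTCoveredCols_eq_of_sameGrid Ts hgrid hne]

/-- The multi-column verdict, too, is the v1.8 verdict or UNDETERMINED (no new FP/FN, as in §2). [folklore] -/
theorem verdict8Cols_eq_or :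
    verdict8Cols Tfloor cols bands = verdict Tfloor cols.flatten bands ∨ verdict8Cols Tfloor cols bands = .UNDETERMINED := by
  unfold verdict8Cols
  split_ifs
  · exact Or.inr rfl
  · exact Or.inl rfl

end cols

/-- **The readings differ only off the product grid.** Two columns (P = 0 and P = 10, encoded by position), T_floor = 4.2 K, all «not»: the
first carries the owed points {6, 10}, the second only {0, 130 …}. POOLED coverage holds (6 and 10 occur somewhere), PER-COLUMN fails ⇒ v1.8 NOT,
pooled-item-8 NOT, per-column item 8 (the pen's, both engines) UNDETERMINED. Such a map is not a product grid ⇒ W1 rejects it before scoring. [folklore] -/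
theorem pooled_not_percolumn :
    lowTCovered (42 / 10) ([column (fun _ => Word.not) ([0, 6, 10, 130, 200] : List ℚ), column (fun _ => Word.not) ([0, 130, 200] : List ℚ)] : List (List (ℚ × Word))).flatten = true
      ∧ lowTCoveredCols (42 / 10) [column (fun _ => Word.not) ([0, 6, 10, 130, 200] : List ℚ), column (fun _ => Word.not) ([0, 130, 200] : List ℚ)] = false
      ∧ verdict (42 / 10) ([column (fun _ => Word.not) ([0, 6, 10, 130, 200] : List ℚ), column (fun _ => Word.not) ([0, 130, 200] : List ℚ)] : List (List (ℚ × Word))).flatten [] = .NOT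
      ∧ verdict8Cols (42 / 10) [column (fun _ => Word.not) ([0, 6, 10, 130, 200] : List ℚ), column (fun _ => Word.not) ([0, 130, 200] : List ℚ)] [] = .UNDETERMINED := by
  refine ⟨?_, ?_, ?_, ?_⟩ <;>
    norm_num [verdict8Cols, lowTCoveredCols, lowTCovered, lowTOwed, verdict, saysSC, saysNOT, relevant, column, T22,
      Word.undetermined_ne_SC, Word.not_ne_SC, Word.undetermined_ne_not, Verdict.UNDETERMINED_ne_NOT, Verdict.SC_ne_NOT]

/-- The pen's selftest shape with TWO columns (M19-like, known-SC, T_floor 0.1 K): both columns sparse ⇒ ABSTAIN; both columns T22 ⇒ the v1.8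
verdict (here NOT ⇒ FN, unchanged by item 8 — coverage is about the grid, not about being right). [folklore] -/
theorem item8_two_columns :
    verdict8Cols (1 / 10) [column (fun _ => Word.not) sparseGrid, column (fun _ => Word.not) sparseGrid] [] = .UNDETERMINED
      ∧ verdict8Cols (1 / 10) [column (fun _ => Word.not) T22, column (fun _ => Word.not) T22] [] = .NOT := by
  constructor <;>
    norm_num [verdict8Cols, lowTCoveredCols, lowTCovered, lowTOwed, verdict, saysSC, saysNOT, relevant, column, sparseGrid, T22,
      Word.undetermined_ne_SC, Word.not_ne_SC, Word.undetermined_ne_not, Verdict.UNDETERMINED_ne_NOT, Verdict.SC_ne_NOT]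

end CellScore

end Summit.Ventures.CertifiedManyBodySolver.Downfold
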